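import Mathlib
import HarnessLib
import Summits.Parity.BatemanHorn.Theses.AlmostPrimeZeros
import Summits.Parity.BatemanHorn.Theorems.AlmostPrimeZerosSystemZeroRepulsionReduction

/-!
# `RepulsionFromNearFar` (route AlmostPrimeZeros, item stmt-Parity-17116)

Glue: `DiscMajorantLog → FarMomentWide → SystemZeroRepulsion`.

The near leaf `DiscMajorantLog` (the one-sided LSD-quality majorant
`‖S_x(z)‖ ≤ A·x·(log x)^{k(Re z − 1)}·exp(C‖z−1‖ log(‖z−1‖+2))` on the disc `‖z − 1‖ ≤ 3 log log x`)
and the far leaf `FarMomentWide` (the wide exponential moment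
`Σ_{n≤x} t^{s_f(n)} ≤ (x+1)·exp(C(t log log x + t²/log log x))`, `1 ≤ t ≤ √(log x)`) together give
the zero repulsion `T_f(x) = Σ_ρ ‖1 − ρ‖⁻² ≤ C_f` of the almost-prime polynomial of every
Bateman–Horn system.  The whole analytic content (Jensen's formula at the free centre `z = 1`,
near zone / far zone split, dyadic layer cake) is the landed, kernel-checked reduction
`Summit.Parity.BatemanHorn.Cruxes.SystemZeroRepulsion.Reduction.SystemZeroRepulsion_of_discMajorantLog_of_farMomentWide`
(file `AlmostPrimeZerosSystemZeroRepulsionReduction.lean`), whose two hypotheses are verbatim the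
bodies of the route defs `DiscMajorantLog` and `FarMomentWide`; this file only records the
implication under the route's name.

Sources: Jensen 1899 (Jensen's formula); Pólya–Szegő 1925 (Part III/V, zeros of polynomials);
Tenenbaum 2015 (II.5–II.6, Selberg–Delange shape of the majorant).
-/

namespace Summit.Parity.BatemanHorn.Theorems

/-- **Item stmt-Parity-17116 (`RepulsionFromNearFar`).**
`DiscMajorantLog → FarMomentWide → SystemZeroRepulsion` for every Bateman–Horn system: the
disc majorant with harmonic exponent `k(Re z − 1) log log x` controls the near zone
`‖1 − ρ‖ ≤ log log x` of `T_f(x) = Σ_ρ ‖1 − ρ‖⁻²` by Jensen's formula at `z = 1`, and the wide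
moment clears the far zone; both steps are the landed reduction
`Reduction.SystemZeroRepulsion_of_discMajorantLog_of_farMomentWide`. -/
theorem RepulsionFromNearFar_proof :
    Summit.Parity.BatemanHorn.Theses.AlmostPrimeZeros.RepulsionFromNearFar := by
  unfold Summit.Parity.BatemanHorn.Theses.AlmostPrimeZeros.RepulsionFromNearFar
    Summit.Parity.BatemanHorn.Theses.AlmostPrimeZeros.DiscMajorantLog
    Summit.Parity.BatemanHorn.Theses.AlmostPrimeZeros.FarMomentWide
  exact Summit.Parity.BatemanHorn.Cruxes.SystemZeroRepulsion.Reduction.SystemZeroRepulsion_of_discMajorantLog_of_farMomentWide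

end Summit.Parity.BatemanHorn.Theorems
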